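import Mathlib.LinearAlgebra.BilinearForm.Orthogonal

/-!
# Route LinearSystemTorelli — crux `LocalTubeSpan` (stmt-HodgeConjecture-2490): Schnell pairs

Helper file (`--supports stmt-HodgeConjecture-2490`, line `Sketch`, stub `stub_pairs`): the
linear-algebra dictionary between the two phrasings of the crux ("local Schnell theorem",
C. Schnell, *Primitive cohomology and the tube mapping*, Math. Z. 268 (2010) = arXiv:0711.3927):

* (i) Schnell's third map `H¹(G_{s₀}, V) → ∏_g V/(g - 1)V` is injective on geometric classes —
  a class `φ` is DETECTED by `g` if `φ(g) ∉ (g - 1)V`;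
* (ii) the tube classes `τ_g(α)` over LOCAL PAIRS (`g ∈ G_{s₀}`, `α ∈ V^g = ker (g - 1)`) span the
  locally visible primitive homology — the period of `ω` over `τ_g(α)` is `⟨α, φ_ω(g)⟩`
  ([Schnell2010] §3 (tube-dual), §8 (identity-g) and Lemma 13).

They are equivalent because a local monodromy operator `g` is an ISOMETRY of the intersection
form `B` on the vanishing cohomology `V`, which is nondegenerate and (being symmetric or skew)
reflexive, and for such `g`

  `((g - 1)V)^⊥ = V^g`  and  `(g - 1)V = (V^g)^⊥`

(`localTubeSpan_orthogonal_range_sub_id`), whence `φ(g) ∈ (g - 1)V` (undetected by `g`) iff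
`⟨α, φ(g)⟩ = 0` for every `g`-invariant `α` (all tube periods over the pairs `(g, α)` vanish):
`localTubeSpan_mem_range_sub_id_iff` (pairing `B α w`, the orientation of Mathlib's
`LinearMap.BilinForm.mem_orthogonal_iff`) and `localTubeSpan_mem_range_sub_id_iff'` (pairing
`B w α`; both hold as `B` is reflexive), and the existential spelling
`localTubeSpan_exists_sub_eq_iff` (`(∃ v, g v - v = w) ↔ ∀ α, g α = α → B α w = 0`).

Proof: `y ⊥ (g - 1)V` iff `B (g x) y = B x y = B (g x) (g y)` for all `x`, iff
`B z (g y - y) = 0` for all `z` (an isometry of a nondegenerate form is injective, hence — the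
space being finite-dimensional — surjective: `localTubeSpan_injective_of_isometry`,
`localTubeSpan_surjective_of_isometry`), iff `g y = y` by nondegeneracy; the second identity is
the first under `W ↦ W^⊥⊥ = W` (`LinearMap.BilinForm.orthogonal_orthogonal`, finite dimension,
nondegenerate reflexive form).

Pure linear algebra over an arbitrary field (Mathlib only); no named facts.

References: [Schnell2010] C. Schnell, Primitive cohomology and the tube mapping, Math. Z. 268
(2010), §3 (the third map, (tube-dual)), §8 Lemma 13.
-/

-- `Summit.HodgeConjecture.HodgeConjecture.Theorems` is the mandated namespace (single-conjunct summit: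
-- Sub = Summit), which `linter.dupNamespace` flags on every declaration; the lakefile turns the
-- linter off tree-wide (weak option), restated here so stand-alone elaboration is warning-free too.
set_option linter.dupNamespace false

noncomputable section

namespace Summit.HodgeConjecture.HodgeConjecture.Theorems

universe u

/-! ### Isometries of a nondegenerate form are automorphisms -/

/-- An isometry `g` (`B (g x) (g y) = B x y`) of a nondegenerate bilinear form is injective:
if `g x = 0` then `B x y = B (g x) (g y) = 0` for every `y`, so `x = 0` (left separation).
[folklore] -/
theorem localTubeSpan_injective_of_isometry {K V : Type u} [Field K] [AddCommGroup V]
    [Module K V] (B : LinearMap.BilinForm K V) (hB : B.Nondegenerate)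
    (g : V →ₗ[K] V) (hg : ∀ x y, B (g x) (g y) = B x y) : Function.Injective g := by
  rw [← LinearMap.ker_eq_bot, LinearMap.ker_eq_bot']
  intro x hx
  refine hB.1 x fun y => ?_
  rw [← hg, hx, LinearMap.BilinForm.zero_left]

/-- An isometry of a nondegenerate bilinear form on a finite-dimensional space is surjective
(an injective endomorphism of a finite-dimensional space is onto). [folklore] -/
theorem localTubeSpan_surjective_of_isometry {K V : Type u} [Field K] [AddCommGroup V]
    [Module K V] [FiniteDimensional K V] (B : LinearMap.BilinForm K V) (hB : B.Nondegenerate)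
    (g : V →ₗ[K] V) (hg : ∀ x y, B (g x) (g y) = B x y) : Function.Surjective g :=
  LinearMap.surjective_of_injective (localTubeSpan_injective_of_isometry B hB g hg)

/-! ### `((g - 1)V)^⊥ = V^g` and `(g - 1)V = (V^g)^⊥` -/

/-- Membership form of `((g - 1)V)^⊥ = V^g`: for an isometry `g` of a nondegenerate bilinear
form `B` on a finite-dimensional space, `y` is (right-)orthogonal to `(g - 1)V`, i.e.
`B (g x - x) y = 0` for all `x`, iff `g y = y`.  (`⇐`: `B (g x) y = B (g x) (g y) = B x y`;
`⇒`: `B (g x) (g y - y) = B x y - B (g x) y = 0` for all `x`, and `g` is onto, so `g y - y = 0`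
by right separation.)  Reflexivity of `B` is not needed here.
[cite: Schnell2010, §3 (tube-dual) and §8 Lemma 13] -/
theorem localTubeSpan_mem_orthogonal_range_sub_id_iff {K V : Type u} [Field K] [AddCommGroup V]
    [Module K V] [FiniteDimensional K V] (B : LinearMap.BilinForm K V) (hB : B.Nondegenerate)
    (g : V →ₗ[K] V) (hg : ∀ x y, B (g x) (g y) = B x y) (y : V) :
    y ∈ B.orthogonal (LinearMap.range (g - LinearMap.id)) ↔ g y = y := by
  rw [LinearMap.BilinForm.mem_orthogonal_iff]
  constructor
  · intro h
    have h1 : ∀ z, B z (g y - y) = 0 := by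
      intro z
      obtain ⟨x, rfl⟩ := localTubeSpan_surjective_of_isometry B hB g hg z
      have hx := h ((g - LinearMap.id : V →ₗ[K] V) x) (LinearMap.mem_range_self _ x)
      rw [LinearMap.sub_apply, LinearMap.id_apply, LinearMap.BilinForm.sub_left,
        sub_eq_zero] at hx
      rw [LinearMap.BilinForm.sub_right, hg, sub_eq_zero]
      exact hx.symm
    exact sub_eq_zero.1 (hB.2 _ h1)
  · intro h n hn
    obtain ⟨x, rfl⟩ := LinearMap.mem_range.1 hn
    rw [LinearMap.sub_apply, LinearMap.id_apply, LinearMap.BilinForm.sub_left, sub_eq_zero]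
    calc B (g x) y = B (g x) (g y) := by rw [h]
      _ = B x y := hg x y

/-- **Schnell pairs — the dictionary** (stub `stub_pairs` of line `Sketch`).  For an isometry
`g` of a nondegenerate reflexive bilinear form `B` on a finite-dimensional space `V`:
`((g - 1)V)^⊥ = V^g := ker (g - 1)` and `(g - 1)V = (V^g)^⊥` (Mathlib's right orthogonal
`B.orthogonal N = {m | ∀ n ∈ N, B n m = 0}`; for reflexive `B` left and right orthogonals agree).
The first identity is `localTubeSpan_mem_orthogonal_range_sub_id_iff`; the second follows by
taking orthogonals, `W^⊥⊥ = W` for a nondegenerate reflexive form in finite dimension.  For the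
crux: a local monodromy operator `g ∈ G_{s₀}` is an isometry of the (symmetric or skew, hence
reflexive; nondegenerate) intersection form on the vanishing cohomology, so "`φ(g) ∈ (g - 1)V`"
(the class is undetected by `g`, [Schnell2010] §3) iff "`⟨α, φ(g)⟩ = 0` for all `α ∈ V^g`" (all
tube periods over the pairs `(g, α)` vanish, [Schnell2010] §8 Lemma 13).
[cite: Schnell2010, §3 (tube-dual) and §8 Lemma 13] -/
theorem localTubeSpan_orthogonal_range_sub_id {K V : Type u} [Field K] [AddCommGroup V]
    [Module K V] [FiniteDimensional K V]
    (B : LinearMap.BilinForm K V) (hB : B.Nondegenerate) (hBr : B.IsRefl)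
    (g : V →ₗ[K] V) (hg : ∀ x y, B (g x) (g y) = B x y) :
    B.orthogonal (LinearMap.range (g - LinearMap.id)) = LinearMap.ker (g - LinearMap.id) ∧
    LinearMap.range (g - LinearMap.id) = B.orthogonal (LinearMap.ker (g - LinearMap.id)) := by
  have h1 : B.orthogonal (LinearMap.range (g - LinearMap.id)) =
      LinearMap.ker (g - LinearMap.id) := by
    refine Submodule.ext fun y => ?_
    rw [localTubeSpan_mem_orthogonal_range_sub_id_iff B hB g hg y, LinearMap.mem_ker,
      LinearMap.sub_apply, LinearMap.id_apply, sub_eq_zero]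
  refine ⟨h1, ?_⟩
  rw [← h1, LinearMap.BilinForm.orthogonal_orthogonal hB hBr]

/-- `V^g = ((g - 1)V)^⊥` — the first identity of `localTubeSpan_orthogonal_range_sub_id`, read
from right to left (for rewriting the invariants). [cite: Schnell2010, §3 (tube-dual) and §8
Lemma 13] -/
theorem localTubeSpan_ker_sub_id_eq_orthogonal_range {K V : Type u} [Field K] [AddCommGroup V]
    [Module K V] [FiniteDimensional K V]
    (B : LinearMap.BilinForm K V) (hB : B.Nondegenerate) (hBr : B.IsRefl)
    (g : V →ₗ[K] V) (hg : ∀ x y, B (g x) (g y) = B x y) :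
    LinearMap.ker (g - LinearMap.id) = B.orthogonal (LinearMap.range (g - LinearMap.id)) :=
  (localTubeSpan_orthogonal_range_sub_id B hB hBr g hg).1.symm

/-- `(g - 1)V = (V^g)^⊥` — the second identity of `localTubeSpan_orthogonal_range_sub_id`.
[cite: Schnell2010, §3 (tube-dual) and §8 Lemma 13] -/
theorem localTubeSpan_range_sub_id_eq_orthogonal_ker {K V : Type u} [Field K] [AddCommGroup V]
    [Module K V] [FiniteDimensional K V]
    (B : LinearMap.BilinForm K V) (hB : B.Nondegenerate) (hBr : B.IsRefl)
    (g : V →ₗ[K] V) (hg : ∀ x y, B (g x) (g y) = B x y) :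
    LinearMap.range (g - LinearMap.id) = B.orthogonal (LinearMap.ker (g - LinearMap.id)) :=
  (localTubeSpan_orthogonal_range_sub_id B hB hBr g hg).2

/-! ### Undetected by `g` iff all pair periods vanish -/

/-- **Undetected iff all tube periods over pairs vanish** (pairing `B α w`, the orientation of
Mathlib's `LinearMap.BilinForm.mem_orthogonal_iff`): for an isometry `g` of a nondegenerate
reflexive form on a finite-dimensional space, `w ∈ (g - 1)V` iff `B α w = 0` for every
`g`-invariant `α` (`α ∈ ker (g - 1)`).  See `localTubeSpan_mem_range_sub_id_iff'` for the pairing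
`B w α`. [cite: Schnell2010, §3 (tube-dual) and §8 Lemma 13] -/
theorem localTubeSpan_mem_range_sub_id_iff {K V : Type u} [Field K] [AddCommGroup V]
    [Module K V] [FiniteDimensional K V]
    (B : LinearMap.BilinForm K V) (hB : B.Nondegenerate) (hBr : B.IsRefl)
    (g : V →ₗ[K] V) (hg : ∀ x y, B (g x) (g y) = B x y) (w : V) :
    w ∈ LinearMap.range (g - LinearMap.id) ↔
      ∀ α ∈ LinearMap.ker (g - LinearMap.id), B α w = 0 := by
  rw [(localTubeSpan_orthogonal_range_sub_id B hB hBr g hg).2,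
    LinearMap.BilinForm.mem_orthogonal_iff]

/-- **Undetected iff all tube periods over pairs vanish** (pairing `B w α`): for an isometry `g`
of a nondegenerate reflexive form on a finite-dimensional space, `w ∈ (g - 1)V` iff `B w α = 0`
for every `g`-invariant `α`; from `localTubeSpan_mem_range_sub_id_iff` by reflexivity of `B`.
[cite: Schnell2010, §3 (tube-dual) and §8 Lemma 13] -/
theorem localTubeSpan_mem_range_sub_id_iff' {K V : Type u} [Field K] [AddCommGroup V]
    [Module K V] [FiniteDimensional K V]
    (B : LinearMap.BilinForm K V) (hB : B.Nondegenerate) (hBr : B.IsRefl)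
    (g : V →ₗ[K] V) (hg : ∀ x y, B (g x) (g y) = B x y) (w : V) :
    w ∈ LinearMap.range (g - LinearMap.id) ↔
      ∀ α ∈ LinearMap.ker (g - LinearMap.id), B w α = 0 := by
  rw [localTubeSpan_mem_range_sub_id_iff B hB hBr g hg w]
  exact ⟨fun h α hα => hBr _ _ (h α hα), fun h α hα => hBr _ _ (h α hα)⟩

/-- **Undetected iff all tube periods over pairs vanish**, existential spelling: `w` is of the
form `g v - v` iff `B α w = 0` for every `α` with `g α = α`.
[cite: Schnell2010, §3 (tube-dual) and §8 Lemma 13] -/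
theorem localTubeSpan_exists_sub_eq_iff {K V : Type u} [Field K] [AddCommGroup V]
    [Module K V] [FiniteDimensional K V]
    (B : LinearMap.BilinForm K V) (hB : B.Nondegenerate) (hBr : B.IsRefl)
    (g : V →ₗ[K] V) (hg : ∀ x y, B (g x) (g y) = B x y) (w : V) :
    (∃ v, g v - v = w) ↔ ∀ α, g α = α → B α w = 0 := by
  have h := localTubeSpan_mem_range_sub_id_iff B hB hBr g hg w
  simp only [LinearMap.mem_range, LinearMap.mem_ker, LinearMap.sub_apply, LinearMap.id_apply,
    sub_eq_zero] at h
  exact h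

end Summit.HodgeConjecture.HodgeConjecture.Theorems

end
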